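import Mathlib
import Summits.ValiantsHypothesis.ValiantsHypothesis.Theorems.NewtonUnitEquationsDissociatedUniformTotalsLaw
import Literature.Computability.AlgebraicComplexity.NewtonPolygonTauProductBounds
import HarnessLib

/-!
# Crux `NewtonUnitEquations.DissociatedUniform` (stmt-ValiantsHypothesis-5905): totals law — the SMALL-THIRD-CURVE regime is a kernel theorem

Companion of `…DissociatedUniformTotalsLaw` (typed law, memo L1/L5) and `…TotalsLawShares` (share bounds).  Memo
`Cruxes/DissociatedUniform/NOTES-d1g3.md` §2 L5 names two PROVABLE regimes of the `n = 3` totals law of model (Q**); this file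
proves the first one ("third curve negligible against the fibres") in the tree's vocabulary, with explicit hypotheses and no
general-position assumption:

* `exists_rep_not_mem_interior` — **localisation.**  If the third curve `c` is FLAT against the pair sumset `S = A + B`
  (every width `⟨w, c z - c z'⟩ ≤ D·(|w₀|+|w₁|)` with `D < δ`, where `δ` is a radius such that every sumset point interior to
  `conv S` carries the closed `δ`-ball inside `conv S`), then EVERY hull vertex of EVERY class is `a x + b y + c (s - x - y)` with
  `a x + b y` a NON-INTERIOR point of `conv S` (a hull vertex of the sumset or a sumset point inside a hull edge).  Proof: a class
  vertex is a strict top for a chart weight `w = (±1, t)` (`KPTT.PlanarMinkowski.mem_extremePoints_iff_charts`); comparing it with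
  the words `(x', y', s - x' - y')` shows that its pair part `p = a x + b y` is within `D·(|w₀|+|w₁|)` of the top of `S` in direction
  `w` (this is `TotalsLaw.Wins.fibre_near_top` of the Shares file, unfolded); an interior point is at depth `≥ δ·(|w₀|+|w₁|)`
  (test point `p + δ·sgn w` of the `δ`-ball), contradiction.
* `classVert_le_bdryCount_of`, `totalVert_le_card_mul_bdryCount_of` — **counting.**  If moreover the pair sums `a x + b y` are
  pairwise distinct (true for every dissociated frame, in particular for all (Q**) designs), the pair part determines the word, so
  `V_s ≤ #∂S` and `T ≤ |G| · #∂S`, `#∂S = bdryCount a b` = the number of non-interior sumset points (`≤ |G|²`; in general position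
  `= vert(S) ≤ vert(A) + vert(B) ≤ 2|G|`, the memo's value `T ≤ 2q²` at this end).
* `totalVert_smul_le_card_mul_bdryCount` — **the regime as printed:** for every `a, b` with distinct pair sums and every `c` there
  is `μ₁ > 0` with `T(a, b, μ • c) ≤ |G| · #∂S` for all `0 ≤ μ ≤ μ₁` (`exists_uniform_radius` supplies `δ`, the width bound of
  `μ • c` is `μ · 2∑_z (|c z 0| + |c z 1|)`).
Honest label: a regime theorem; the totals law `TotalsLawThree C` itself stays OPEN; nothing here bears on `VP ≠ VNP`.
[folklore]
-/

set_option linter.dupNamespace false -- `ValiantsHypothesis.ValiantsHypothesis` (summit = problem) in every name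

open scoped BigOperators Pointwise
open Matrix

namespace Summit.ValiantsHypothesis.ValiantsHypothesis.Theorems.NewtonUnitEquationsDissociatedUniform

namespace TotalsLaw

open Literature.Computability.AlgebraicComplexity.KPTT.PlanarMinkowski

variable {G : Type*} [AddCommGroup G] [Fintype G]

/-- The pair sumset `S = A + B = {a x + b y : x, y ∈ G}` of the first two curves (the union of all fibres `P_r`). -/
def pairPts (a b : G → (Fin 2 → ℝ)) : Set (Fin 2 → ℝ) :=
  Set.range fun p : G × G => a p.1 + b p.2

/-- `#∂S`: the number of points of the pair sumset `S` that are NOT interior points of `conv S` (the sumset points on the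
boundary of its hull: hull vertices and points inside hull edges). -/
noncomputable def bdryCount (a b : G → (Fin 2 → ℝ)) : ℕ :=
  {p | p ∈ pairPts a b ∧ p ∉ interior (convexHull ℝ (pairPts a b))}.ncard

omit [Fintype G] in
/-- Every fibre lies in the pair sumset. [folklore] -/
theorem fibrePts_subset_pairPts (a b : G → (Fin 2 → ℝ)) (r : G) : fibrePts a b r ⊆ pairPts a b := by
  rintro p ⟨x, rfl⟩
  exact ⟨(x, r - x), rfl⟩

omit [AddCommGroup G] in
/-- `#∂S ≤ |G|²` (the sumset has at most `|G|²` points). [folklore] -/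
theorem bdryCount_le_card_sq (a b : G → (Fin 2 → ℝ)) : bdryCount a b ≤ Fintype.card G ^ 2 := by
  unfold bdryCount
  have hfin : (pairPts a b).Finite := Set.finite_range _
  calc {p | p ∈ pairPts a b ∧ p ∉ interior (convexHull ℝ (pairPts a b))}.ncard
      ≤ (pairPts a b).ncard := Set.ncard_le_ncard (fun p hp => hp.1) hfin
    _ ≤ Fintype.card (G × G) := ncard_range_le_card _
    _ = Fintype.card G ^ 2 := by rw [Fintype.card_prod, sq]

/-! ### Two planar bookkeeping facts: widths of a finite curve, depth of an interior point -/

/-- The pairing with a difference is controlled by the `ℓ¹` size of the weight: `⟨w, u - u'⟩ ≤ (|w₀|+|w₁|)·(|u₀|+|u₁|+|u'₀|+|u'₁|)`.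
[folklore] -/
theorem dotProduct_sub_le (w u u' : Fin 2 → ℝ) :
    w ⬝ᵥ (u - u') ≤ (|w 0| + |w 1|) * (|u 0| + |u 1| + |u' 0| + |u' 1|) := by
  have h : w ⬝ᵥ (u - u') = w 0 * (u 0 - u' 0) + w 1 * (u 1 - u' 1) := by
    simp [dotProduct, Fin.sum_univ_two]
  rw [h]
  have h0 : w 0 * (u 0 - u' 0) ≤ |w 0| * (|u 0| + |u' 0|) :=
    (le_abs_self _).trans (by rw [abs_mul]; exact mul_le_mul_of_nonneg_left (abs_sub _ _) (abs_nonneg _))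
  have h1 : w 1 * (u 1 - u' 1) ≤ |w 1| * (|u 1| + |u' 1|) :=
    (le_abs_self _).trans (by rw [abs_mul]; exact mul_le_mul_of_nonneg_left (abs_sub _ _) (abs_nonneg _))
  nlinarith [abs_nonneg (w 0), abs_nonneg (w 1), abs_nonneg (u 0), abs_nonneg (u 1), abs_nonneg (u' 0),
    abs_nonneg (u' 1)]

omit [AddCommGroup G] in
/-- **Width bound of a finite curve.**  With `D₀ = 2 ∑_z (|c z 0| + |c z 1|)`: `⟨w, c z - c z'⟩ ≤ D₀ · (|w₀| + |w₁|)` for all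
`w, z, z'`. [folklore] -/
theorem dotProduct_curve_sub_le (c : G → (Fin 2 → ℝ)) (w : Fin 2 → ℝ) (z z' : G) :
    w ⬝ᵥ (c z - c z') ≤ (2 * ∑ u, (|c u 0| + |c u 1|)) * (|w 0| + |w 1|) := by
  have hz : |c z 0| + |c z 1| ≤ ∑ u, (|c u 0| + |c u 1|) :=
    Finset.single_le_sum (f := fun u => |c u 0| + |c u 1|) (fun u _ => by positivity) (Finset.mem_univ z)
  have hz' : |c z' 0| + |c z' 1| ≤ ∑ u, (|c u 0| + |c u 1|) :=
    Finset.single_le_sum (f := fun u => |c u 0| + |c u 1|) (fun u _ => by positivity) (Finset.mem_univ z')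
  have hw : 0 ≤ |w 0| + |w 1| := by positivity
  calc w ⬝ᵥ (c z - c z') ≤ (|w 0| + |w 1|) * (|c z 0| + |c z 1| + |c z' 0| + |c z' 1|) := dotProduct_sub_le w (c z) (c z')
    _ ≤ (|w 0| + |w 1|) * (2 * ∑ u, (|c u 0| + |c u 1|)) := mul_le_mul_of_nonneg_left (by linarith) hw
    _ = (2 * ∑ u, (|c u 0| + |c u 1|)) * (|w 0| + |w 1|) := mul_comm _ _

/-- **Depth of an interior point.**  If the closed `δ`-ball (sup metric) around `p` lies in a set `K` all of whose points satisfy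
`⟨w, ·⟩ ≤ m`, then `⟨w, p⟩ + δ·(|w₀| + |w₁|) ≤ m` (test point `p + δ·sgn w`). [folklore] -/
theorem dotProduct_add_mul_le_of_closedBall_subset {K : Set (Fin 2 → ℝ)} {p w : Fin 2 → ℝ} {δ m : ℝ} (hδ : 0 ≤ δ)
    (hball : Metric.closedBall p δ ⊆ K) (hK : ∀ u ∈ K, w ⬝ᵥ u ≤ m) :
    w ⬝ᵥ p + δ * (|w 0| + |w 1|) ≤ m := by
  -- the test point `p + δ·sgn w`
  set sg : Fin 2 → ℝ := fun i => if 0 ≤ w i then 1 else -1 with hsg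
  have hsgabs : ∀ i, |δ * sg i| = δ := by
    intro i
    simp only [hsg]
    split_ifs <;> simp [abs_of_nonneg hδ]
  have hsgmul : ∀ i, w i * sg i = |w i| := by
    intro i
    simp only [hsg]
    split_ifs with h
    · rw [mul_one, abs_of_nonneg h]
    · rw [mul_neg_one, abs_of_neg (not_le.1 h)]
  have hmem : p + δ • sg ∈ Metric.closedBall p δ := by
    rw [Metric.mem_closedBall, dist_pi_le_iff hδ]
    intro i
    rw [Real.dist_eq]
    simp [hsgabs i]
  have h := hK _ (hball hmem)
  have hexp : w ⬝ᵥ (p + δ • sg) = w ⬝ᵥ p + δ * (|w 0| + |w 1|) := by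
    rw [dotProduct_add, dotProduct_smul, smul_eq_mul]
    simp [dotProduct, Fin.sum_univ_two, hsgmul]
  linarith [hexp ▸ h]

/-- The convex hull of a set lies in every closed half-plane `{u | ⟨w, u⟩ ≤ m}` containing the set. [folklore] -/
theorem convexHull_subset_halfPlane {S : Set (Fin 2 → ℝ)} {w : Fin 2 → ℝ} {m : ℝ} (hS : ∀ u ∈ S, w ⬝ᵥ u ≤ m) :
    ∀ u ∈ convexHull ℝ S, w ⬝ᵥ u ≤ m := by
  have hconv : Convex ℝ {u : Fin 2 → ℝ | w ⬝ᵥ u ≤ m} :=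
    convex_halfSpace_le ⟨fun x y => dotProduct_add w x y, fun t x => by rw [dotProduct_smul]⟩ m
  exact fun u hu => convexHull_min (fun u hu => hS u hu) hconv hu

/-! ### Localisation: under a flat third curve every class vertex sits over a boundary point of the sumset -/

/-- **Localisation (the small-third-curve regime).**  Let `D < δ`, every width of the third curve be `≤ D·(|w₀|+|w₁|)`, and every
sumset point interior to `conv S` carry the closed `δ`-ball inside `conv S`.  Then every hull vertex of the class `s` is a word
`a x + b y + c (s - x - y)` whose pair part `a x + b y` is NOT an interior point of `conv S`. [folklore] -/
theorem exists_rep_not_mem_interior (a b c : G → (Fin 2 → ℝ)) (s : G) {D δ : ℝ}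
    (hD : ∀ (w : Fin 2 → ℝ) (z z' : G), w ⬝ᵥ (c z - c z') ≤ D * (|w 0| + |w 1|)) (hDδ : D < δ)
    (hball : ∀ x y : G, a x + b y ∈ interior (convexHull ℝ (pairPts a b)) →
      Metric.closedBall (a x + b y) δ ⊆ convexHull ℝ (pairPts a b))
    {v : Fin 2 → ℝ} (hv : v ∈ (convexHull ℝ (classPts a b c s)).extremePoints ℝ) :
    ∃ x y : G, v = a x + b y + c (s - x - y) ∧ a x + b y ∉ interior (convexHull ℝ (pairPts a b)) := by
  classical
  -- a Finset model of the class
  set F : Finset (Fin 2 → ℝ) := Finset.univ.image fun p : G × G => a p.1 + b p.2 + c (s - p.1 - p.2) with hFdef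
  have hF : (F : Set (Fin 2 → ℝ)) = classPts a b c s := by
    rw [hFdef, Finset.coe_image, Finset.coe_univ, Set.image_univ]
    rfl
  rw [← hF] at hv
  -- a chart weight exposing `v`
  obtain ⟨σ, t, hσ, htop⟩ : ∃ σ t : ℝ, (σ = 1 ∨ σ = -1) ∧ IsStrictTop ![σ, t] F v := by
    rcases mem_extremePoints_iff_charts.1 hv with ⟨t, ht⟩ | ⟨t, ht⟩
    · exact ⟨1, t, Or.inl rfl, ht⟩
    · exact ⟨-1, t, Or.inr rfl, ht⟩
  set w : Fin 2 → ℝ := ![σ, t] with hw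
  have hN : 0 < |w 0| + |w 1| := by
    have h0 : |w 0| = 1 := by
      rcases hσ with h | h <;> simp [hw, h]
    have h1 : 0 ≤ |w 1| := abs_nonneg _
    linarith
  obtain ⟨⟨x, y⟩, -, hxy⟩ := Finset.mem_image.1 htop.mem
  refine ⟨x, y, hxy.symm, fun hint => ?_⟩
  -- every sumset point is within `D·N(w)` of the pair part `p = a x + b y`
  have hS : ∀ u ∈ pairPts a b, w ⬝ᵥ u ≤ w ⬝ᵥ (a x + b y) + D * (|w 0| + |w 1|) := by
    rintro u ⟨⟨x', y'⟩, rfl⟩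
    have hmem : a x' + b y' + c (s - x' - y') ∈ F := Finset.mem_image.2 ⟨(x', y'), Finset.mem_univ _, rfl⟩
    have h1 := htop.le hmem
    rw [← hxy] at h1
    have h2 := hD w (s - x - y) (s - x' - y')
    simp only [dotProduct_add, dotProduct_sub] at h1 h2 ⊢
    linarith
  -- the interior point `p` is at depth `≥ δ·N(w)`: contradiction with `D < δ`
  have hdepth := dotProduct_add_mul_le_of_closedBall_subset (le_of_lt (lt_of_le_of_lt (by
      have := hD w (s - x - y) (s - x - y)
      rw [sub_self, dotProduct_zero] at this
      nlinarith) hDδ)) (hball x y hint) (convexHull_subset_halfPlane hS)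
  nlinarith

/-! ### Counting: distinct pair sums ⇒ `V_s ≤ #∂S`, `T ≤ |G|·#∂S` -/

/-- **`V_s ≤ #∂S` in the small-third-curve regime** (hypotheses of `exists_rep_not_mem_interior`, plus: the pair sums
`a x + b y` are pairwise distinct, so the pair part determines the word). [folklore] -/
theorem classVert_le_bdryCount_of (a b c : G → (Fin 2 → ℝ)) (s : G) {D δ : ℝ}
    (hD : ∀ (w : Fin 2 → ℝ) (z z' : G), w ⬝ᵥ (c z - c z') ≤ D * (|w 0| + |w 1|)) (hDδ : D < δ)
    (hball : ∀ x y : G, a x + b y ∈ interior (convexHull ℝ (pairPts a b)) →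
      Metric.closedBall (a x + b y) δ ⊆ convexHull ℝ (pairPts a b))
    (hab : Function.Injective fun p : G × G => a p.1 + b p.2) :
    classVert a b c s ≤ bdryCount a b := by
  classical
  set B : Set (G × G) := {q | a q.1 + b q.2 ∉ interior (convexHull ℝ (pairPts a b))} with hB
  set g : G × G → (Fin 2 → ℝ) := fun q => a q.1 + b q.2 + c (s - q.1 - q.2) with hg
  have hsub : (convexHull ℝ (classPts a b c s)).extremePoints ℝ ⊆ g '' B := by
    intro v hv
    obtain ⟨x, y, hv', hnot⟩ := exists_rep_not_mem_interior a b c s hD hDδ hball hv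
    exact ⟨(x, y), hnot, hv'.symm⟩
  have hBfin : B.Finite := Set.toFinite B
  have himg : (fun q : G × G => a q.1 + b q.2) '' B = {p | p ∈ pairPts a b ∧ p ∉ interior (convexHull ℝ (pairPts a b))} := by
    ext p
    simp only [Set.mem_image, Set.mem_setOf_eq, hB, pairPts, Set.mem_range]
    constructor
    · rintro ⟨q, hq, rfl⟩
      exact ⟨⟨q, rfl⟩, hq⟩
    · rintro ⟨⟨q, rfl⟩, hq⟩
      exact ⟨q, hq, rfl⟩
  unfold classVert bdryCount
  calc ((convexHull ℝ (classPts a b c s)).extremePoints ℝ).ncard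
      ≤ (g '' B).ncard := Set.ncard_le_ncard hsub (hBfin.image g)
    _ ≤ B.ncard := Set.ncard_image_le hBfin
    _ = ((fun q : G × G => a q.1 + b q.2) '' B).ncard := (Set.ncard_image_of_injective B hab).symm
    _ = _ := by rw [himg]

/-- **`T ≤ |G| · #∂S` in the small-third-curve regime.** [folklore] -/
theorem totalVert_le_card_mul_bdryCount_of (a b c : G → (Fin 2 → ℝ)) {D δ : ℝ}
    (hD : ∀ (w : Fin 2 → ℝ) (z z' : G), w ⬝ᵥ (c z - c z') ≤ D * (|w 0| + |w 1|)) (hDδ : D < δ)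
    (hball : ∀ x y : G, a x + b y ∈ interior (convexHull ℝ (pairPts a b)) →
      Metric.closedBall (a x + b y) δ ⊆ convexHull ℝ (pairPts a b))
    (hab : Function.Injective fun p : G × G => a p.1 + b p.2) :
    totalVert a b c ≤ Fintype.card G * bdryCount a b := by
  unfold totalVert
  calc ∑ s, classVert a b c s ≤ ∑ _s : G, bdryCount a b :=
        Finset.sum_le_sum fun s _ => classVert_le_bdryCount_of a b c s hD hDδ hball hab
    _ = Fintype.card G * bdryCount a b := by rw [Finset.sum_const, Finset.card_univ, smul_eq_mul]

/-! ### The regime as printed: a uniform inner radius exists, and small multiples of any third curve are flat -/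

/-- **Uniform inner radius.**  There is `δ > 0` such that every sumset point interior to `conv S` carries the closed `δ`-ball
inside `conv S` (finitely many interior points, each with its own ball). [folklore] -/
theorem exists_uniform_radius (a b : G → (Fin 2 → ℝ)) :
    ∃ δ : ℝ, 0 < δ ∧ ∀ x y : G, a x + b y ∈ interior (convexHull ℝ (pairPts a b)) →
      Metric.closedBall (a x + b y) δ ⊆ convexHull ℝ (pairPts a b) := by
  classical
  have hpt : ∀ q : G × G, ∃ δ : ℝ, 0 < δ ∧ (a q.1 + b q.2 ∈ interior (convexHull ℝ (pairPts a b)) →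
      Metric.closedBall (a q.1 + b q.2) δ ⊆ convexHull ℝ (pairPts a b)) := by
    intro q
    by_cases h : a q.1 + b q.2 ∈ interior (convexHull ℝ (pairPts a b))
    · obtain ⟨ε, hε, hεball⟩ := Metric.mem_nhds_iff.1 (mem_interior_iff_mem_nhds.1 h)
      exact ⟨ε / 2, by positivity, fun _ => (Metric.closedBall_subset_ball (by linarith)).trans hεball⟩
    · exact ⟨1, one_pos, fun h' => absurd h' h⟩
  choose δ hδpos hδ using hpt
  have hne : (Finset.univ : Finset (G × G)).Nonempty := ⟨(0, 0), Finset.mem_univ _⟩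
  refine ⟨Finset.univ.inf' hne δ, (Finset.lt_inf'_iff _).2 fun q _ => hδpos q, fun x y hint => ?_⟩
  have hle : Finset.univ.inf' hne δ ≤ δ (x, y) := Finset.inf'_le _ (Finset.mem_univ _)
  exact (Metric.closedBall_subset_closedBall hle).trans (hδ (x, y) hint)

/-- **The small-third-curve regime of the `n = 3` totals law** (memo NOTES-d1g3 §2 L5, first regime, as a kernel theorem):
for curves `a, b` with pairwise distinct pair sums and ANY third curve `c` there is `μ₁ > 0` such that
`T(a, b, μ • c) ≤ |G| · #∂S` for all `0 ≤ μ ≤ μ₁` (`#∂S = bdryCount a b ≤ |G|²`, `= vert(A + B) ≤ 2|G|` in general position).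
[folklore] -/
theorem totalVert_smul_le_card_mul_bdryCount (a b c : G → (Fin 2 → ℝ))
    (hab : Function.Injective fun p : G × G => a p.1 + b p.2) :
    ∃ μ₁ : ℝ, 0 < μ₁ ∧ ∀ μ : ℝ, 0 ≤ μ → μ ≤ μ₁ →
      totalVert a b (μ • c) ≤ Fintype.card G * bdryCount a b := by
  obtain ⟨δ, hδ, hball⟩ := exists_uniform_radius a b
  set D₀ : ℝ := 2 * ∑ u, (|c u 0| + |c u 1|) with hD₀
  have hD₀nn : 0 ≤ D₀ := by positivity
  refine ⟨δ / (D₀ + 1), by positivity, fun μ hμ0 hμ1 => ?_⟩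
  have hD : ∀ (w : Fin 2 → ℝ) (z z' : G), w ⬝ᵥ ((μ • c) z - (μ • c) z') ≤ (μ * D₀) * (|w 0| + |w 1|) := by
    intro w z z'
    rw [Pi.smul_apply, Pi.smul_apply, ← smul_sub, dotProduct_smul, smul_eq_mul, mul_assoc]
    exact mul_le_mul_of_nonneg_left (dotProduct_curve_sub_le c w z z') hμ0
  have hlt : μ * D₀ < δ := by
    have h1 : μ * D₀ ≤ δ / (D₀ + 1) * D₀ := mul_le_mul_of_nonneg_right hμ1 hD₀nn
    have h2 : δ / (D₀ + 1) * D₀ < δ := by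
      rw [div_mul_eq_mul_div, div_lt_iff₀ (by positivity)]
      nlinarith
    exact lt_of_le_of_lt h1 h2
  exact totalVert_le_card_mul_bdryCount_of a b (μ • c) hD hlt hball hab

end TotalsLaw

end Summit.ValiantsHypothesis.ValiantsHypothesis.Theorems.NewtonUnitEquationsDissociatedUniform
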